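import Summits.Schanuel.Schanuel.Theorems.ZilberEacSuperellipticSheets
import Summits.Schanuel.Schanuel.Theorems.ZilberEacRowsBezout
import Summits.Schanuel.Schanuel.Theorems.ZilberEacBranchKernel
import HarnessLib

/-!
# Arbitrary base branches, LIII (b): EVERY polynomial fibre `y₀ = R(x₀, x₁)` over EVERY curve
# `x₁^k = P(x₀)`, `k ≥ 3` — case ∧ dense

HONEST FRAMING.  Cell `pub-schanuel` (Zilber's Exponential-Algebraic Closedness, case ladder;
host summit Schanuel), seat 2, gen 30.  Over `C : x₁^k = P(x₀)` (`k ≥ 3`, `P` monic of degree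
`M ≥ 1` with a simple root) the non-real sheets of file XXXIV give a good direction for EVERY fibre
germ `ψ(s)s^{L}`, `L ∈ ℤ` (file XXXII).  For a polynomial fibre `y₀ = R(x₀, x₁)` the value along a
sheet is put in this form by the isolated-zeros principle (**`exists_cyclicSheet_normalForm`**); the
only input is that the value is not identically zero along the sheet, which is the Bézout lemma of
file LIII (a) applied to the rows `G = R mod (x₁^k − P)` (**`exists_rows_reduction`**, `deg_{x₁} G < k`).
Result: **`unprojectedDensityQuestion_cyclicCover_polyFibreMv`** — for `k ≥ 3` and EVERY
`R ∈ ℂ[x₀, x₁]` not vanishing identically on `C`, `{x₁^k − P(x₀) = 0, y₀ = R(x₀, x₁)}` is in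
Mantova–Masser's case AND has Zariski-dense exponential points (constant fibres included: file
XXXIV).  With files L–LII (`k = 2`) this decides Mantova–Masser's typed question for every
non-constant polynomial fibre over every cyclic cover `x₁^k = P(x₀)` of the line (`k ≥ 2`, `P` with a
simple root).  Decided instances of an OPEN question (Mantova–Masser, PLMS 2024 §1 p. 5); EC(3,2)
OPEN; NOT Schanuel's conjecture (neither used nor implied); EAC ⇏ SC.
-/

noncomputable section

open Filter Topology Set Complex Polynomial
open Literature.NumberTheory.Transcendental Literature.ModelTheory.Zilber
open Literature.ModelTheory.ExponentialFields

set_option linter.dupNamespace false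

namespace Summit.Schanuel.Schanuel.Theorems

section CyclicCover

variable (P : ℂ[X])

/-! ## Part A. Rows modulo `x₁^k − P(x₀)` -/

/-- **Reduction to rows of `x₁`-degree `< k`.**  For every `R ∈ ℂ[x₀, x₁]` and `k ≥ 1` there is
`G ∈ ℂ[x₀][x₁]` with `deg_{x₁} G < k` and `R(x, y) = G(x, y)` whenever `y^k = P(x)`. [folklore] -/
theorem exists_rows_reduction {k : ℕ} (hk : 1 ≤ k) (R : MvPolynomial (Fin 2) ℂ) :
    ∃ G : ℂ[X][X], G.natDegree < k ∧ ∀ x y : ℂ, y ^ k = P.eval x →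
      MvPolynomial.eval ![x, y] R = (G.map (Polynomial.evalRingHom x)).eval y := by
  classical
  obtain ⟨Φr, hΦr⟩ := exists_rowsEquiv
  set F : ℂ[X][X] := X ^ k - C P with hFdef
  have hFm : F.Monic := Polynomial.monic_X_pow_sub_C _ (by omega)
  have hFdeg : F.natDegree = k := Polynomial.natDegree_X_pow_sub_C
  have hF1 : F ≠ 1 := by
    intro h
    have := congrArg Polynomial.natDegree h
    rw [hFdeg, Polynomial.natDegree_one] at this
    omega
  refine ⟨Φr R %ₘ F, ?_, fun x y hy => ?_⟩
  · have := Polynomial.natDegree_modByMonic_lt (Φr R) hFm hF1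
    rwa [hFdeg] at this
  · rw [hΦr]
    conv_lhs => rw [← Polynomial.modByMonic_add_div (Φr R) F]
    rw [Polynomial.map_add, Polynomial.map_mul, Polynomial.eval_add, Polynomial.eval_mul]
    have hF0 : (F.map (Polynomial.evalRingHom x)).eval y = 0 := by
      rw [hFdef]
      simp [hy]
    rw [hF0, zero_mul, add_zero]

/-! ## Part B. The normal form of the fibre value along a sheet -/

/-- **Normal form along a sheet of `x₁^k = P(x₀)`.**  `G ∈ ℂ[x₀][x₁]` nonzero with
`deg_{x₁} G < k`, `Φ` a sheet at infinity (`x₀ = s^{-k}`, `x₁ = Φ(s)s^{-M}`), `P` with a simple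
root: `G(x₀, x₁) = ψ(s)s^{L}` for small `s ≠ 0`, `ψ` analytic, `ψ(0) ≠ 0`, `L ∈ ℤ`. [folklore] -/
theorem exists_cyclicSheet_normalForm {k : ℕ} (hk : 1 ≤ k) {r : ℂ} (hr : P.IsRoot r)
    (hr1 : P.derivative.eval r ≠ 0) (G : ℂ[X][X]) (hG : G ≠ 0) (hdeg : G.natDegree < k)
    {Φ : ℂ → ℂ} (hΦan : AnalyticAt ℂ Φ 0)
    (hsheet : ∀ᶠ s in 𝓝[≠] (0 : ℂ), (Φ s * (s ^ P.natDegree)⁻¹) ^ k - P.eval (s ^ k)⁻¹ = 0) :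
    ∃ (ψ : ℂ → ℂ) (L : ℤ), AnalyticAt ℂ ψ 0 ∧ ψ 0 ≠ 0 ∧
      ∀ᶠ s in 𝓝[≠] (0 : ℂ),
        (G.map (Polynomial.evalRingHom (s ^ k)⁻¹)).eval (Φ s * (s ^ P.natDegree)⁻¹) =
          ψ s * s ^ L := by
  classical
  set M : ℕ := P.natDegree with hMdef
  set n : ℕ := G.natDegree with hn
  -- polar forms of the rows
  have hrow : ∀ j : ℕ, ∃ U : ℂ → ℂ, AnalyticAt ℂ U 0 ∧
      ∀ s : ℂ, s ≠ 0 → (G.coeff j).eval (s ^ k)⁻¹ = U s * (s ^ (k * (G.coeff j).natDegree))⁻¹ := by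
    intro j
    obtain ⟨U, hUan, -, hUev⟩ :=
      exists_polarForm_eval (G.coeff j) (U := fun _ : ℂ => (1 : ℂ)) analyticAt_const hk
    refine ⟨U, hUan, fun s hs => ?_⟩
    have h := hUev s hs
    rw [one_mul, inv_pow, inv_pow] at h
    exact h
  choose U hUan hUev using hrow
  -- exponents
  set N₁ : ℕ → ℕ := fun j => k * (G.coeff j).natDegree + j * M with hN₁
  set N : ℕ := ∑ j ∈ Finset.range (n + 1), N₁ j with hNdef
  have hN₁le : ∀ j ∈ Finset.range (n + 1), N₁ j ≤ N := fun j hj =>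
    Finset.single_le_sum (fun i _ => Nat.zero_le (N₁ i)) hj
  set g : ℂ → ℂ := fun s => ∑ j ∈ Finset.range (n + 1), U j s * Φ s ^ j * s ^ (N - N₁ j) with hg
  have hid : AnalyticAt ℂ (fun s : ℂ => s) 0 := analyticAt_id
  have hgan : AnalyticAt ℂ g 0 := by
    rw [hg]
    refine Finset.analyticAt_fun_sum _ fun j _ => ?_
    exact ((hUan j).mul (hΦan.pow j)).mul (hid.pow _)
  -- `f(s) = g(s)·s^{-N}` for `s ≠ 0`
  have hfexp : ∀ s : ℂ, (G.map (Polynomial.evalRingHom (s ^ k)⁻¹)).eval (Φ s * (s ^ M)⁻¹) =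
      ∑ j ∈ Finset.range (n + 1), (G.coeff j).eval (s ^ k)⁻¹ * (Φ s * (s ^ M)⁻¹) ^ j := by
    intro s
    rw [Polynomial.eval_map, Polynomial.eval₂_eq_sum_range]
    rfl
  have hgf : ∀ s : ℂ, s ≠ 0 → (G.map (Polynomial.evalRingHom (s ^ k)⁻¹)).eval (Φ s * (s ^ M)⁻¹) =
      g s * s ^ (-(N : ℤ)) := by
    intro s hs
    rw [hfexp, hg, Finset.sum_mul]
    refine Finset.sum_congr rfl fun j hj => ?_
    rw [hUev j s hs, zpow_neg, zpow_natCast, pow_sub₀ s hs (hN₁le j hj)]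
    simp only [hN₁, pow_add, pow_mul, mul_pow, inv_pow]
    field_simp
    ring
  -- `g` is not identically zero near `0`
  have hg_ne : ¬ ∀ᶠ s in 𝓝 (0 : ℂ), g s = 0 := by
    intro hg0
    apply hG
    refine rows_eq_zero_of_eventually_zero_along_cyclicSheet P hk hr hr1 G hdeg hsheet ?_
    filter_upwards [eventually_nhdsWithin_of_eventually_nhds hg0, self_mem_nhdsWithin] with s hgs hs0
    rw [hgf s hs0, hgs, zero_mul]
  obtain ⟨m, ψ, hψan, hψ0, hgψ⟩ := hgan.exists_eventuallyEq_pow_smul_nonzero_iff.2 hg_ne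
  refine ⟨ψ, (m : ℤ) - (N : ℤ), hψan, hψ0, ?_⟩
  filter_upwards [eventually_nhdsWithin_of_eventually_nhds hgψ, self_mem_nhdsWithin] with s h2 hs0
  have hs0' : s ≠ 0 := hs0
  rw [hgf s hs0', h2, sub_zero, smul_eq_mul, zpow_sub₀ hs0', zpow_natCast, zpow_neg, zpow_natCast,
    div_eq_mul_inv]
  ring

/-! ## Part C. Density for `k ≥ 3` -/

/-- **Every polynomial fibre over `x₁^k = P(x₀)`, `k ≥ 3`: dense.**  `P` monic of degree `≥ 1`
with a simple root, `R ∈ ℂ[x₀, x₁]` nonzero somewhere on the curve: `{x₁^k − P(x₀) = 0,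
y₀ = R(x₀, x₁)}` has Zariski-dense exponential points (a non-real sheet, file XXXIV; any order `L`,
file XXXII). [cite: MantovaMasser2023, §1 Further remarks, p. 5 (the question, open in general)]
(new) -/
theorem unprojectedDense_cyclicCover_polyFibreMv {k : ℕ} (hk : 3 ≤ k) (hP : P.Monic)
    (hM : 1 ≤ P.natDegree) {r : ℂ} (hr : P.IsRoot r) (hr1 : P.derivative.eval r ≠ 0)
    (R : MvPolynomial (Fin 2) ℂ)
    (hR : ∃ x : Fin 2 → ℂ, MvPolynomial.eval x
        (MvPolynomial.X 1 ^ k - Polynomial.aeval (MvPolynomial.X 0 : MvPolynomial (Fin 2) ℂ) P) = 0 ∧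
      MvPolynomial.eval x R ≠ 0) :
    UnprojectedDense {w : Fin 2 ⊕ Fin 2 → ℂ |
      MvPolynomial.eval ![w (Sum.inl 0), w (Sum.inl 1)]
          (MvPolynomial.X 1 ^ k - Polynomial.aeval (MvPolynomial.X 0 : MvPolynomial (Fin 2) ℂ) P) = 0 ∧
      w (Sum.inr 0) = MvPolynomial.eval ![w (Sum.inl 0), w (Sum.inl 1)] R} := by
  classical
  set M : ℕ := P.natDegree with hMdef
  have hk1 : 1 ≤ k := by omega
  obtain ⟨G, hGdeg, hGev⟩ := exists_rows_reduction P hk1 R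
  have hG0 : G ≠ 0 := by
    intro hG
    obtain ⟨x, hxC, hxR⟩ := hR
    apply hxR
    have hy : x 1 ^ k = P.eval (x 0) := by
      rw [eval_superellipticMv] at hxC
      exact sub_eq_zero.1 hxC
    have hx : x = ![x 0, x 1] := by
      funext i
      fin_cases i <;> simp
    rw [hx, hGev _ _ hy, hG, Polynomial.map_zero, Polynomial.eval_zero]
  have hirr := irreducible_superellipticMv P hk1 hr hr1
  have hS := isIrreducibleClosed_curveGraphFibre R hirr
  have hdim := zariskiDim_curveGraphFibre R hirr
  obtain ⟨ζ, z, hζ, hz, hre⟩ := exists_sheet_direction hk M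
  obtain ⟨Φ, hΦan, hΦ0, hsheet⟩ := superelliptic_sheet_facts P hk1 hP hζ
  obtain ⟨ψ, L, hψan, hψ0, hf⟩ := exists_cyclicSheet_normalForm P hk1 hr hr1 G hG0 hGdeg hΦan hsheet
  refine unprojectedDense_branch_poleFibre_of_exists_direction hS (le_of_eq hdim) hk1 hM L hψan hψ0
    hΦan ⟨z, hz, by rw [hΦ0]; exact hre⟩ ?_
  filter_upwards [hsheet, hf] with s hs hfs
  have hy : (Φ s * (s ^ M)⁻¹) ^ k = P.eval (s ^ k)⁻¹ := sub_eq_zero.1 hs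
  refine ⟨?_, ?_⟩
  · simp only [Sum.elim_inl, Matrix.cons_val_zero, Matrix.cons_val_one]
    rw [eval_superellipticMv]
    simpa only [Matrix.cons_val_zero, Matrix.cons_val_one] using hs
  · simp only [Sum.elim_inr, Sum.elim_inl, Matrix.cons_val_zero, Matrix.cons_val_one]
    rw [hGev _ _ hy, hfs]

/-! ## Part D. Mantova–Masser's case and the packaged statement -/

/-- **The cylinder `{x₁^k − P(x₀) = 0, y₀ = R(x₀, x₁)}` is in Mantova–Masser's case** (`k ≥ 2`,
`P` with a simple root, `R` nonzero somewhere on the curve). (new) -/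
theorem mmCase_cyclicCover_polyFibreMv {k : ℕ} (hk : 2 ≤ k) {r : ℂ} (hr : P.IsRoot r)
    (hr1 : P.derivative.eval r ≠ 0) (R : MvPolynomial (Fin 2) ℂ)
    (hR : ∃ x : Fin 2 → ℂ, MvPolynomial.eval x
        (MvPolynomial.X 1 ^ k - Polynomial.aeval (MvPolynomial.X 0 : MvPolynomial (Fin 2) ℂ) P) = 0 ∧
      MvPolynomial.eval x R ≠ 0) :
    MMCaseDimPiOneFree {w : Fin 2 ⊕ Fin 2 → ℂ |
      MvPolynomial.eval ![w (Sum.inl 0), w (Sum.inl 1)]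
          (MvPolynomial.X 1 ^ k - Polynomial.aeval (MvPolynomial.X 0 : MvPolynomial (Fin 2) ℂ) P) = 0 ∧
      w (Sum.inr 0) = MvPolynomial.eval ![w (Sum.inl 0), w (Sum.inl 1)] R} := by
  have hP0 : P ≠ 0 := by
    rintro rfl
    simp at hr1
  exact mmCase_curveGraphFibre (irreducible_superellipticMv P (by omega) hr hr1) hR
    (superelliptic_not_on_line P hk hP0)

/-- **Mantova–Masser's question for EVERY polynomial fibre over `x₁^k = P(x₀)`, `k ≥ 3`:
case ∧ dense.**  `P` monic of degree `≥ 1` with a simple root; `R ∈ ℂ[x₀, x₁]` nonzero somewhere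
on the curve (constant fibres `θ ≠ 0` included). [cite: MantovaMasser2023, §1 Further remarks, p. 5
(the question, open in general)] (new) -/
theorem unprojectedDensityQuestion_cyclicCover_polyFibreMv {k : ℕ} (hk : 3 ≤ k) (hP : P.Monic)
    (hM : 1 ≤ P.natDegree) {r : ℂ} (hr : P.IsRoot r) (hr1 : P.derivative.eval r ≠ 0)
    (R : MvPolynomial (Fin 2) ℂ)
    (hR : ∃ x : Fin 2 → ℂ, MvPolynomial.eval x
        (MvPolynomial.X 1 ^ k - Polynomial.aeval (MvPolynomial.X 0 : MvPolynomial (Fin 2) ℂ) P) = 0 ∧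
      MvPolynomial.eval x R ≠ 0) :
    MMCaseDimPiOneFree {w : Fin 2 ⊕ Fin 2 → ℂ |
        MvPolynomial.eval ![w (Sum.inl 0), w (Sum.inl 1)]
            (MvPolynomial.X 1 ^ k - Polynomial.aeval (MvPolynomial.X 0 : MvPolynomial (Fin 2) ℂ) P) = 0 ∧
        w (Sum.inr 0) = MvPolynomial.eval ![w (Sum.inl 0), w (Sum.inl 1)] R} ∧
      UnprojectedDense {w : Fin 2 ⊕ Fin 2 → ℂ |
        MvPolynomial.eval ![w (Sum.inl 0), w (Sum.inl 1)]
            (MvPolynomial.X 1 ^ k - Polynomial.aeval (MvPolynomial.X 0 : MvPolynomial (Fin 2) ℂ) P) = 0 ∧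
        w (Sum.inr 0) = MvPolynomial.eval ![w (Sum.inl 0), w (Sum.inl 1)] R} :=
  ⟨mmCase_cyclicCover_polyFibreMv P (by omega) hr hr1 R hR,
    unprojectedDense_cyclicCover_polyFibreMv P hk hP hM hr hr1 R hR⟩

/-- **Plain coordinates, three-term fibres**: `{x₁^k − P(x₀) = 0, y₀ = A(x₀) + x₁B(x₀) + x₁²E(x₀)}`
(`k ≥ 3`; `P` monic of degree `≥ 1` with a simple root; the fibre value nonzero at some point of
the curve) is in the case AND dense. [cite: MantovaMasser2023, §1 Further remarks, p. 5 (the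
question, open in general)] (new) -/
theorem unprojectedDensityQuestion_cyclicCover_threeTermFibre {k : ℕ} (hk : 3 ≤ k) (hP : P.Monic)
    (hM : 1 ≤ P.natDegree) {r : ℂ} (hr : P.IsRoot r) (hr1 : P.derivative.eval r ≠ 0)
    (A B E : ℂ[X]) (hne : ∃ x y : ℂ, y ^ k = P.eval x ∧
      A.eval x + y * B.eval x + y ^ 2 * E.eval x ≠ 0) :
    MMCaseDimPiOneFree {w : Fin 2 ⊕ Fin 2 → ℂ |
        w (Sum.inl 1) ^ k - P.eval (w (Sum.inl 0)) = 0 ∧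
        w (Sum.inr 0) = A.eval (w (Sum.inl 0)) + w (Sum.inl 1) * B.eval (w (Sum.inl 0)) +
          w (Sum.inl 1) ^ 2 * E.eval (w (Sum.inl 0))} ∧
      UnprojectedDense {w : Fin 2 ⊕ Fin 2 → ℂ |
        w (Sum.inl 1) ^ k - P.eval (w (Sum.inl 0)) = 0 ∧
        w (Sum.inr 0) = A.eval (w (Sum.inl 0)) + w (Sum.inl 1) * B.eval (w (Sum.inl 0)) +
          w (Sum.inl 1) ^ 2 * E.eval (w (Sum.inl 0))} := by
  set R : MvPolynomial (Fin 2) ℂ := Polynomial.aeval (MvPolynomial.X 0 : MvPolynomial (Fin 2) ℂ) A +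
      MvPolynomial.X 1 * Polynomial.aeval (MvPolynomial.X 0 : MvPolynomial (Fin 2) ℂ) B +
      MvPolynomial.X 1 ^ 2 * Polynomial.aeval (MvPolynomial.X 0 : MvPolynomial (Fin 2) ℂ) E with hRdef
  have hRev : ∀ x : Fin 2 → ℂ, MvPolynomial.eval x R =
      A.eval (x 0) + x 1 * B.eval (x 0) + x 1 ^ 2 * E.eval (x 0) := by
    intro x
    simp only [hRdef, map_add, map_mul, map_pow, MvPolynomial.eval_X,
      Literature.ModelTheory.Zilber.eval_polynomial_aeval_X]
  have e : {w : Fin 2 ⊕ Fin 2 → ℂ |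
        MvPolynomial.eval ![w (Sum.inl 0), w (Sum.inl 1)]
            (MvPolynomial.X 1 ^ k - Polynomial.aeval (MvPolynomial.X 0 : MvPolynomial (Fin 2) ℂ) P) = 0 ∧
        w (Sum.inr 0) = MvPolynomial.eval ![w (Sum.inl 0), w (Sum.inl 1)] R} =
      {w : Fin 2 ⊕ Fin 2 → ℂ |
        w (Sum.inl 1) ^ k - P.eval (w (Sum.inl 0)) = 0 ∧
        w (Sum.inr 0) = A.eval (w (Sum.inl 0)) + w (Sum.inl 1) * B.eval (w (Sum.inl 0)) +
          w (Sum.inl 1) ^ 2 * E.eval (w (Sum.inl 0))} := by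
    ext w
    simp only [Set.mem_setOf_eq, eval_superellipticMv, hRev, Matrix.cons_val_zero,
      Matrix.cons_val_one]
  obtain ⟨x, y, hy, hne⟩ := hne
  have h := unprojectedDensityQuestion_cyclicCover_polyFibreMv P hk hP hM hr hr1 R
    ⟨![x, y], by rw [eval_superellipticMv]; simp [hy], by rw [hRev]; simpa using hne⟩
  rw [e] at h
  exact h

end CyclicCover

/-- Example: `{x₁³ = x₀³ + 1, y₀ = x₁²}`: case ∧ dense (three-term fibre with `A = B = 0`, `E = 1`).
[cite: MantovaMasser2023, §1 Further remarks, p. 5 (the question, open in general)] (new) -/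
theorem unprojectedDensityQuestion_fermatCubic_fibre_x₁_sq :
    MMCaseDimPiOneFree {w : Fin 2 ⊕ Fin 2 → ℂ |
        w (Sum.inl 1) ^ 3 - (Polynomial.X ^ 3 + 1 : ℂ[X]).eval (w (Sum.inl 0)) = 0 ∧
        w (Sum.inr 0) = w (Sum.inl 1) ^ 2} ∧
      UnprojectedDense {w : Fin 2 ⊕ Fin 2 → ℂ |
        w (Sum.inl 1) ^ 3 - (Polynomial.X ^ 3 + 1 : ℂ[X]).eval (w (Sum.inl 0)) = 0 ∧
        w (Sum.inr 0) = w (Sum.inl 1) ^ 2} := by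
  have hm : (Polynomial.X ^ 3 + 1 : ℂ[X]).Monic := by
    simpa using Polynomial.monic_X_pow_add_C (1 : ℂ) (by norm_num : (3 : ℕ) ≠ 0)
  have hd : (Polynomial.X ^ 3 + 1 : ℂ[X]).natDegree = 3 := by
    simpa using Polynomial.natDegree_X_pow_add_C (n := 3) (r := (1 : ℂ))
  have hr : (Polynomial.X ^ 3 + 1 : ℂ[X]).IsRoot (-1) := by
    simp [Polynomial.IsRoot]
    norm_num
  have hr1 : (Polynomial.derivative (Polynomial.X ^ 3 + 1 : ℂ[X])).eval (-1) ≠ 0 := by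
    rw [Polynomial.derivative_add, Polynomial.derivative_one, Polynomial.derivative_X_pow, add_zero,
      Polynomial.eval_mul, Polynomial.eval_C, Polynomial.eval_pow, Polynomial.eval_X]
    norm_num
  have e : {w : Fin 2 ⊕ Fin 2 → ℂ |
        w (Sum.inl 1) ^ 3 - (Polynomial.X ^ 3 + 1 : ℂ[X]).eval (w (Sum.inl 0)) = 0 ∧
        w (Sum.inr 0) = (0 : ℂ[X]).eval (w (Sum.inl 0)) + w (Sum.inl 1) * (0 : ℂ[X]).eval (w (Sum.inl 0)) +
          w (Sum.inl 1) ^ 2 * (1 : ℂ[X]).eval (w (Sum.inl 0))} =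
      {w : Fin 2 ⊕ Fin 2 → ℂ |
        w (Sum.inl 1) ^ 3 - (Polynomial.X ^ 3 + 1 : ℂ[X]).eval (w (Sum.inl 0)) = 0 ∧
        w (Sum.inr 0) = w (Sum.inl 1) ^ 2} := by
    ext w
    simp only [Set.mem_setOf_eq, Polynomial.eval_zero, Polynomial.eval_one, mul_zero, zero_add, mul_one]
  have h := unprojectedDensityQuestion_cyclicCover_threeTermFibre _ (le_refl 3) hm (by rw [hd]; norm_num)
    hr hr1 0 0 1 ⟨0, 1, by norm_num, by norm_num⟩
  rw [e] at h
  exact h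

/-- Example: `{x₁³ = x₀³ + 1, y₀ = x₀ + x₁²}`: case ∧ dense (three-term fibre with `A = X`,
`B = 0`, `E = 1`). [cite: MantovaMasser2023, §1 Further remarks, p. 5 (the question, open in
general)] (new) -/
theorem unprojectedDensityQuestion_fermatCubic_fibre_x₀_add_x₁_sq :
    MMCaseDimPiOneFree {w : Fin 2 ⊕ Fin 2 → ℂ |
        w (Sum.inl 1) ^ 3 - (Polynomial.X ^ 3 + 1 : ℂ[X]).eval (w (Sum.inl 0)) = 0 ∧
        w (Sum.inr 0) = w (Sum.inl 0) + w (Sum.inl 1) ^ 2} ∧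
      UnprojectedDense {w : Fin 2 ⊕ Fin 2 → ℂ |
        w (Sum.inl 1) ^ 3 - (Polynomial.X ^ 3 + 1 : ℂ[X]).eval (w (Sum.inl 0)) = 0 ∧
        w (Sum.inr 0) = w (Sum.inl 0) + w (Sum.inl 1) ^ 2} := by
  have hm : (Polynomial.X ^ 3 + 1 : ℂ[X]).Monic := by
    simpa using Polynomial.monic_X_pow_add_C (1 : ℂ) (by norm_num : (3 : ℕ) ≠ 0)
  have hd : (Polynomial.X ^ 3 + 1 : ℂ[X]).natDegree = 3 := by
    simpa using Polynomial.natDegree_X_pow_add_C (n := 3) (r := (1 : ℂ))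
  have hr : (Polynomial.X ^ 3 + 1 : ℂ[X]).IsRoot (-1) := by
    simp [Polynomial.IsRoot]
    norm_num
  have hr1 : (Polynomial.derivative (Polynomial.X ^ 3 + 1 : ℂ[X])).eval (-1) ≠ 0 := by
    rw [Polynomial.derivative_add, Polynomial.derivative_one, Polynomial.derivative_X_pow, add_zero,
      Polynomial.eval_mul, Polynomial.eval_C, Polynomial.eval_pow, Polynomial.eval_X]
    norm_num
  have e : {w : Fin 2 ⊕ Fin 2 → ℂ |
        w (Sum.inl 1) ^ 3 - (Polynomial.X ^ 3 + 1 : ℂ[X]).eval (w (Sum.inl 0)) = 0 ∧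
        w (Sum.inr 0) = (Polynomial.X : ℂ[X]).eval (w (Sum.inl 0)) +
          w (Sum.inl 1) * (0 : ℂ[X]).eval (w (Sum.inl 0)) +
          w (Sum.inl 1) ^ 2 * (1 : ℂ[X]).eval (w (Sum.inl 0))} =
      {w : Fin 2 ⊕ Fin 2 → ℂ |
        w (Sum.inl 1) ^ 3 - (Polynomial.X ^ 3 + 1 : ℂ[X]).eval (w (Sum.inl 0)) = 0 ∧
        w (Sum.inr 0) = w (Sum.inl 0) + w (Sum.inl 1) ^ 2} := by
    ext w
    simp only [Set.mem_setOf_eq, Polynomial.eval_zero, Polynomial.eval_one, Polynomial.eval_X, mul_zero,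
      add_zero, mul_one]
  have h := unprojectedDensityQuestion_cyclicCover_threeTermFibre _ (le_refl 3) hm (by rw [hd]; norm_num)
    hr hr1 Polynomial.X 0 1 ⟨0, 1, by norm_num, by norm_num⟩
  rw [e] at h
  exact h

end Summit.Schanuel.Schanuel.Theorems

end
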